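import Summits.QuantumAdvantage.AdviceFreeQNC0.AffBells26SingleSurvivor
import HarnessLib

/-!
# The TWO-TEST COINCIDENCE LEMMA on `≥ 5` coins (planner qn-p1 g26, ROUND-25 §5.2; the combinatorial core of `TwoSurvivorCriterion`)

Prover seat qn-prover-3 g14.  Pure `ZMod 3` combinatorics on a finite set `C` of "coins", `#C ≥ 5`, for two coefficient vectors
`γ, γ' : C → ZMod 3` (the coin parts of two affine MOD₃ tests, read at a base point of the fibre).

* **`twoTest_eq_or_neg`** — if the zero patterns of the PAIR sums and of the FOUR-element sums agree
  (`γ_k + γ_l = 0 ⟺ γ'_k + γ'_l = 0`, `γ_k+γ_l+γ_m+γ_n = 0 ⟺ γ'_k+…+γ'_n = 0` for distinct coins) and one of `γ, γ'` has two non-zero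
  coins, then `γ' = γ` on `C` or `γ' = −γ` on `C`.  (Planner: "two affine MOD₃ tests agree as Boolean functions on a parity class with
  `Z ≥ 5` coins only if their coin parts are ± each other or both have coin-support ≤ 1"; the even-subset hypothesis is what the
  cube constraint Q2 delivers for two surviving rows at a base point where both tests fire.)  Proof: (A) a zero of `γ` is a zero of
  `γ'` (else a short case analysis on the pairs through two non-zero coins `i, j` of `γ` and two further coins contradicts a pair or
  a four-set); (A') hence `γ'` also has two non-zero coins and the zero sets coincide; (B) on the common support the pair condition
  makes `γ'_k·γ_k` constant, i.e. `γ' = σγ` with one global sign `σ`.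
* **`avoid_lemma`** — if no pair sum and no four-sum hits a fixed `a ≠ 0` then `γ` has at most one non-zero coin (the case of a base
  point where the test never fires on the even sub-cube).
All finite `ZMod 3` reasoning is delegated to `decide`d universally quantified mini-lemmas.

WHAT THIS IS NOT: instrument for the (NP₀) rung of crux stmt-QuantumAdvantage-22907 (route DWalkThree); the assembly into
`TwoSurvivorCriterion` is the sibling file `AffBells26TwoSurvivor.lean`; separation NOT moved.
-/

namespace Summit.QuantumAdvantage.AdviceFreeQNC0

namespace AffBells26

open Finset

/-! ### `ZMod 3` mini-lemmas (all by `decide`) -/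

/-- Two non-zero residues are equal or opposite. -/
theorem z3_eq_or_neg : ∀ a b : ZMod 3, a ≠ 0 → b ≠ 0 → b = a ∨ b = -a := by decide

/-- Step A, case 1: `w ≠ 0`, `γ'_i, γ'_j ∉ {−w}`, `γ'_i + γ'_j = 0` force `γ'_i = γ'_j = 0`. -/
theorem z3_A1 : ∀ w a b : ZMod 3, w ≠ 0 → w + a ≠ 0 → w + b ≠ 0 → a + b = 0 → a = 0 ∧ b = 0 := by decide

/-- Step A, case 1 at a further coin: the two pair conditions through `±γ_i` force `γ_m = 0`, `γ'_m ≠ 0`. -/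
theorem z3_A1m : ∀ v c e : ZMod 3, v ≠ 0 → (v + c = 0 ↔ e = 0) → (-v + c = 0 ↔ e = 0) → c = 0 ∧ e ≠ 0 := by decide

/-- Step A, case 1, the end: `w ≠ 0`, `w + e = 0`, `w + e' = 0`, `e + e' = 0` is impossible. -/
theorem z3_A1end : ∀ w e e' : ZMod 3, w ≠ 0 → w + e = 0 → w + e' = 0 → e + e' = 0 → False := by decide

/-- Step A, case 2: a residue not opposite to `w ≠ 0` is `0` or `w`. -/
theorem z3_A2 : ∀ w a : ZMod 3, w ≠ 0 → w + a ≠ 0 → a = 0 ∨ a = w := by decide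

/-- Step A, case 2a at a further coin. -/
theorem z3_A2a : ∀ v w c e : ZMod 3, v ≠ 0 → w ≠ 0 → (0 + c = 0 ↔ w + e = 0) → (v + c = 0 ↔ w + e = 0) →
    (v + v + 0 + c = 0 ↔ w + w + w + e = 0) → c = v ∧ e = 0 := by decide

/-- Step A, case 2a, the end. -/
theorem z3_A2a_end : ∀ v : ZMod 3, v ≠ 0 → ¬ (v + v = 0 ↔ (0 : ZMod 3) + 0 = 0) := by decide

/-- Step A, case 2b at a further coin. -/
theorem z3_A2b : ∀ v w c e : ZMod 3, v ≠ 0 → w ≠ 0 → (v + c = 0 ↔ w + e = 0) → (v + c = 0 ↔ 0 + e = 0) →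
    (0 + c = 0 ↔ w + e = 0) → c = v ∧ e = w := by decide

/-- Step A, case 2b, the end: a four-sum `3v = 0` against `4w ≠ 0`. -/
theorem z3_A2b_end : ∀ v w : ZMod 3, w ≠ 0 → ¬ (v + 0 + v + v = 0 ↔ w + w + w + w = 0) := by decide

/-- Step B: on a common support the pair condition makes `γ'·γ` constant. -/
theorem z3_B : ∀ a b a' b' : ZMod 3, a ≠ 0 → b ≠ 0 → a' ≠ 0 → b' ≠ 0 → (a + b = 0 ↔ a' + b' = 0) → a' * a = b' * b := by
  decide

/-- Step B: reading off the sign. -/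
theorem z3_B' : ∀ a a' s : ZMod 3, a ≠ 0 → a' * a = s → a' = s * a := by decide

/-- Step B: the sign is `±1`. -/
theorem z3_sign : ∀ a a' : ZMod 3, a ≠ 0 → a' ≠ 0 → a' * a = 1 ∨ a' * a = -1 := by decide

/-- Avoidance, equal case. -/
theorem z3_V1 : ∀ v a c : ZMod 3, v ≠ 0 → a ≠ 0 → v + v ≠ a → v + c ≠ a → c ≠ 0 ∧ a = v := by decide

/-- Avoidance, equal case at two further coins. -/
theorem z3_V2 : ∀ v c c' : ZMod 3, v ≠ 0 → c + c' ≠ v → v + v + c + c' ≠ v → c + c' = 0 := by decide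

/-- Avoidance, opposite case at a further coin. -/
theorem z3_V3 : ∀ v a c : ZMod 3, v ≠ 0 → a ≠ 0 → v + c ≠ a → -v + c ≠ a → c = a := by decide

/-- Avoidance, opposite case, the end. -/
theorem z3_V4 : ∀ v a : ZMod 3, v ≠ 0 → a ≠ 0 → v + a + a + a ≠ a → -v + a + a + a ≠ a → False := by decide

/-! ### Choosing further coins -/

variable {ι : Type*} [DecidableEq ι]

/-- In a set of `≥ 5` elements there are two distinct elements avoiding three given ones. -/
theorem exists_two_avoiding (C : Finset ι) (hC : 5 ≤ C.card) (i j k : ι) :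
    ∃ m ∈ C, ∃ m' ∈ C, m ≠ m' ∧ m ≠ i ∧ m ≠ j ∧ m ≠ k ∧ m' ≠ i ∧ m' ≠ j ∧ m' ≠ k := by
  have hcard : 1 < (((C.erase i).erase j).erase k).card := by
    have h1 := card_erase_le (s := C) (a := i)
    have h1' : C.card - 1 ≤ (C.erase i).card := pred_card_le_card_erase
    have h2' : (C.erase i).card - 1 ≤ ((C.erase i).erase j).card := pred_card_le_card_erase
    have h3' : ((C.erase i).erase j).card - 1 ≤ (((C.erase i).erase j).erase k).card := pred_card_le_card_erase
    omega
  obtain ⟨m, hm, m', hm', hne⟩ := one_lt_card.1 hcard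
  simp only [mem_erase] at hm hm'
  exact ⟨m, hm.2.2.2, m', hm'.2.2.2, hne, hm.2.2.1, hm.2.1, hm.1, hm'.2.2.1, hm'.2.1, hm'.1⟩

/-- In a set of `≥ 5` elements there are three distinct elements avoiding two given ones. -/
theorem exists_three_avoiding (C : Finset ι) (hC : 5 ≤ C.card) (i j : ι) :
    ∃ m ∈ C, ∃ m' ∈ C, ∃ n ∈ C, m ≠ m' ∧ m ≠ n ∧ m' ≠ n ∧ m ≠ i ∧ m ≠ j ∧ m' ≠ i ∧ m' ≠ j ∧ n ≠ i ∧ n ≠ j := by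
  have hcard : 2 < ((C.erase i).erase j).card := by
    have h1' : C.card - 1 ≤ (C.erase i).card := pred_card_le_card_erase
    have h2' : (C.erase i).card - 1 ≤ ((C.erase i).erase j).card := pred_card_le_card_erase
    omega
  obtain ⟨m, hm, m', hm', n, hn, hmm, hmn, hm'n⟩ := two_lt_card.1 hcard
  simp only [mem_erase] at hm hm' hn
  exact ⟨m, hm.2.2, m', hm'.2.2, n, hn.2.2, hmm, hmn, hm'n, hm.2.1, hm.1, hm'.2.1, hm'.1, hn.2.1, hn.1⟩

/-! ### Step A: zeros of `γ` are zeros of `γ'` -/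

/-- The pair and four-set hypotheses. -/
def PairAgree (C : Finset ι) (γ γ' : ι → ZMod 3) : Prop :=
  ∀ k ∈ C, ∀ l ∈ C, k ≠ l → (γ k + γ l = 0 ↔ γ' k + γ' l = 0)

/-- The four-set hypothesis. -/
def QuadAgree (C : Finset ι) (γ γ' : ι → ZMod 3) : Prop :=
  ∀ k ∈ C, ∀ l ∈ C, ∀ m ∈ C, ∀ n ∈ C, k ≠ l → k ≠ m → k ≠ n → l ≠ m → l ≠ n → m ≠ n →
    (γ k + γ l + γ m + γ n = 0 ↔ γ' k + γ' l + γ' m + γ' n = 0)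

omit [DecidableEq ι] in
/-- Both hypotheses are symmetric in `γ, γ'`. -/
theorem pairAgree_symm {C : Finset ι} {γ γ' : ι → ZMod 3} (h : PairAgree C γ γ') : PairAgree C γ' γ :=
  fun k hk l hl hkl => (h k hk l hl hkl).symm

omit [DecidableEq ι] in
/-- Symmetry of the four-set hypothesis. -/
theorem quadAgree_symm {C : Finset ι} {γ γ' : ι → ZMod 3} (h : QuadAgree C γ γ') : QuadAgree C γ' γ :=
  fun k hk l hl m hm n hn h1 h2 h3 h4 h5 h6 => (h k hk l hl m hm n hn h1 h2 h3 h4 h5 h6).symm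

/-- **Step A.** If `γ` has two non-zero coins then every zero of `γ` on `C` is a zero of `γ'`. -/
theorem zero_of_zero (C : Finset ι) (hC : 5 ≤ C.card) (γ γ' : ι → ZMod 3) (h2 : PairAgree C γ γ') (h4 : QuadAgree C γ γ')
    {i j : ι} (hi : i ∈ C) (hj : j ∈ C) (hij : i ≠ j) (hγi : γ i ≠ 0) (hγj : γ j ≠ 0)
    {k : ι} (hk : k ∈ C) (hγk : γ k = 0) : γ' k = 0 := by
  by_contra hw
  have hki : k ≠ i := fun h => hγi (h ▸ hγk)
  have hkj : k ≠ j := fun h => hγj (h ▸ hγk)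
  -- pairs through k
  have hPi : γ' k + γ' i ≠ 0 := fun h => by
    have := (h2 k hk i hi hki).2 h; rw [hγk, zero_add] at this; exact hγi this
  have hPj : γ' k + γ' j ≠ 0 := fun h => by
    have := (h2 k hk j hj hkj).2 h; rw [hγk, zero_add] at this; exact hγj this
  -- two further coins
  obtain ⟨m, hm, m', hm', hmm, hmi, hmj, hmk, hm'i, hm'j, hm'k⟩ := exists_two_avoiding C hC i j k
  -- the pair conditions we need, with γ k = 0 substituted
  have Pkm := h2 k hk m hm (Ne.symm hmk)
  have Pkm' := h2 k hk m' hm' (Ne.symm hm'k)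
  rw [hγk] at Pkm Pkm'
  have Pim := h2 i hi m hm (Ne.symm hmi)
  have Pim' := h2 i hi m' hm' (Ne.symm hm'i)
  have Pjm := h2 j hj m hm (Ne.symm hmj)
  have Pjm' := h2 j hj m' hm' (Ne.symm hm'j)
  have Pmm' := h2 m hm m' hm' hmm
  by_cases hsum : γ i + γ j = 0
  · -- case 1: γ_j = -γ_i
    have hij' := (h2 i hi j hj hij).1 hsum
    obtain ⟨h0i, h0j⟩ := z3_A1 (γ' k) (γ' i) (γ' j) hw hPi hPj hij'
    have hγj' : γ j = -γ i := by
      have : γ j = -γ i + (γ i + γ j) := by ring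
      rw [this, hsum, add_zero]
    rw [h0i, zero_add] at Pim Pim'
    rw [h0j, zero_add, hγj'] at Pjm Pjm'
    obtain ⟨hm0, hm0'⟩ := z3_A1m (γ i) (γ m) (γ' m) hγi Pim Pjm
    obtain ⟨hm'0, hm'0'⟩ := z3_A1m (γ i) (γ m') (γ' m') hγi Pim' Pjm'
    rw [hm0, add_zero] at Pkm
    rw [hm'0, add_zero] at Pkm'
    rw [hm0, hm'0, add_zero] at Pmm'
    exact z3_A1end (γ' k) (γ' m) (γ' m') hw (Pkm.1 rfl) (Pkm'.1 rfl) (Pmm'.1 rfl)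
  · -- case 2: γ_j = γ_i
    have hij' : γ' i + γ' j ≠ 0 := fun h => hsum ((h2 i hi j hj hij).2 h)
    have hγj' : γ j = γ i := by
      rcases z3_eq_or_neg (γ i) (γ j) hγi hγj with h | h
      · exact h
      · exfalso; apply hsum; rw [h]; ring
    rw [hγj'] at Pjm Pjm'
    have hcases : (γ' i = γ' k ∧ γ' j = γ' k) ∨ (γ' i = γ' k ∧ γ' j = 0) ∨ (γ' i = 0 ∧ γ' j = γ' k) := by
      rcases z3_A2 (γ' k) (γ' i) hw hPi with ha | ha <;> rcases z3_A2 (γ' k) (γ' j) hw hPj with hb | hb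
      · exfalso; apply hij'; rw [ha, hb, add_zero]
      · exact Or.inr (Or.inr ⟨ha, hb⟩)
      · exact Or.inr (Or.inl ⟨ha, hb⟩)
      · exact Or.inl ⟨ha, hb⟩
    rcases hcases with ⟨hi', hj'⟩ | ⟨hi', hj'⟩ | ⟨hi', hj'⟩
    · -- 2a
      rw [hi'] at Pim Pim'
      have Q := h4 i hi j hj k hk m hm hij (Ne.symm hki) (Ne.symm hmi) (Ne.symm hkj) (Ne.symm hmj) (Ne.symm hmk)
      have Q' := h4 i hi j hj k hk m' hm' hij (Ne.symm hki) (Ne.symm hm'i) (Ne.symm hkj) (Ne.symm hm'j) (Ne.symm hm'k)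
      rw [hγj', hγk, hi', hj'] at Q Q'
      obtain ⟨hcm, hem⟩ := z3_A2a (γ i) (γ' k) (γ m) (γ' m) hγi hw Pkm Pim Q
      obtain ⟨hcm', hem'⟩ := z3_A2a (γ i) (γ' k) (γ m') (γ' m') hγi hw Pkm' Pim' Q'
      rw [hcm, hcm', hem, hem'] at Pmm'
      exact z3_A2a_end (γ i) hγi Pmm'
    · -- 2b
      rw [hi'] at Pim Pim'
      rw [hj'] at Pjm Pjm'
      obtain ⟨hcm, hem⟩ := z3_A2b (γ i) (γ' k) (γ m) (γ' m) hγi hw Pim Pjm Pkm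
      obtain ⟨hcm', hem'⟩ := z3_A2b (γ i) (γ' k) (γ m') (γ' m') hγi hw Pim' Pjm' Pkm'
      have Q := h4 i hi k hk m hm m' hm' (Ne.symm hki) (Ne.symm hmi) (Ne.symm hm'i) (Ne.symm hmk) (Ne.symm hm'k) hmm
      rw [hγk, hi', hcm, hcm', hem, hem'] at Q
      exact z3_A2b_end (γ i) (γ' k) hw Q
    · -- 2c (symmetric: the roles of i and j)
      rw [hi'] at Pim Pim'
      rw [hj'] at Pjm Pjm'
      obtain ⟨hcm, hem⟩ := z3_A2b (γ i) (γ' k) (γ m) (γ' m) hγi hw Pjm Pim Pkm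
      obtain ⟨hcm', hem'⟩ := z3_A2b (γ i) (γ' k) (γ m') (γ' m') hγi hw Pjm' Pim' Pkm'
      have Q := h4 j hj k hk m hm m' hm' (Ne.symm hkj) (Ne.symm hmj) (Ne.symm hm'j) (Ne.symm hmk) (Ne.symm hm'k) hmm
      rw [hγj', hγk, hj', hcm, hcm', hem, hem'] at Q
      exact z3_A2b_end (γ i) (γ' k) hw Q

/-- **Step A'.** If `γ` has two non-zero coins, so has `γ'`. -/
theorem two_nonzero_of_two_nonzero (C : Finset ι) (hC : 5 ≤ C.card) (γ γ' : ι → ZMod 3) (h2 : PairAgree C γ γ')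
    {i j : ι} (hi : i ∈ C) (hj : j ∈ C) (hij : i ≠ j) (hγi : γ i ≠ 0) (hγj : γ j ≠ 0) :
    ∃ i' ∈ C, ∃ j' ∈ C, i' ≠ j' ∧ γ' i' ≠ 0 ∧ γ' j' ≠ 0 := by
  by_contra hno
  push Not at hno
  -- at most one non-zero coin for γ': every coin other than one exceptional `e` is a zero of γ'
  -- hence among {i, j} and two further coins, three are zeros of γ', and their γ-pair sums vanish
  have key : ∀ p ∈ C, ∀ q ∈ C, p ≠ q → γ' p = 0 → γ' q = 0 → γ p + γ q = 0 := by
    intro p hp q hq hpq hp0 hq0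
    exact (h2 p hp q hq hpq).2 (by rw [hp0, hq0, add_zero])
  obtain ⟨m, hm, m', hm', hmm, hmi, hmj, -, hm'i, hm'j, -⟩ := exists_two_avoiding C hC i j i
  -- among i, j, m, m' at most one has γ' ≠ 0
  have hz : ∀ p ∈ C, ∀ q ∈ C, p ≠ q → γ' p = 0 ∨ γ' q = 0 := by
    intro p hp q hq hpq
    by_contra h
    push Not at h
    exact h.2 (hno p hp q hq hpq h.1)
  -- at most one of i, j, m, m' is a non-zero coin of γ'; the other three have vanishing γ-pair sums
  by_cases hi0 : γ' i = 0
  · by_cases hj0 : γ' j = 0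
    · rcases hz m hm m' hm' hmm with hm0 | hm'0
      · exact hγi (zmod3_three_pairs (γ i) (γ j) (γ m) (key i hi j hj hij hi0 hj0) (key i hi m hm (Ne.symm hmi) hi0 hm0)
          (key j hj m hm (Ne.symm hmj) hj0 hm0))
      · exact hγi (zmod3_three_pairs (γ i) (γ j) (γ m') (key i hi j hj hij hi0 hj0)
          (key i hi m' hm' (Ne.symm hm'i) hi0 hm'0) (key j hj m' hm' (Ne.symm hm'j) hj0 hm'0))
    · have hm0 : γ' m = 0 := (hz j hj m hm (Ne.symm hmj)).resolve_left hj0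
      have hm'0 : γ' m' = 0 := (hz j hj m' hm' (Ne.symm hm'j)).resolve_left hj0
      exact hγi (zmod3_three_pairs (γ i) (γ m) (γ m') (key i hi m hm (Ne.symm hmi) hi0 hm0)
        (key i hi m' hm' (Ne.symm hm'i) hi0 hm'0) (key m hm m' hm' hmm hm0 hm'0))
  · have hj0 : γ' j = 0 := (hz i hi j hj hij).resolve_left hi0
    have hm0 : γ' m = 0 := (hz i hi m hm (Ne.symm hmi)).resolve_left hi0
    have hm'0 : γ' m' = 0 := (hz i hi m' hm' (Ne.symm hm'i)).resolve_left hi0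
    exact hγj (zmod3_three_pairs (γ j) (γ m) (γ m') (key j hj m hm (Ne.symm hmj) hj0 hm0)
      (key j hj m' hm' (Ne.symm hm'j) hj0 hm'0) (key m hm m' hm' hmm hm0 hm'0))

/-! ### The coincidence lemma -/

/-- **The two-test coincidence lemma** (`#C ≥ 5`): matching zero patterns of pair sums and four-sums, and two non-zero coins for one
of the two vectors, force `γ' = γ` or `γ' = −γ` on `C`. -/
theorem twoTest_eq_or_neg (C : Finset ι) (hC : 5 ≤ C.card) (γ γ' : ι → ZMod 3) (h2 : PairAgree C γ γ') (h4 : QuadAgree C γ γ')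
    (hsupp : ∃ i ∈ C, ∃ j ∈ C, i ≠ j ∧ ((γ i ≠ 0 ∧ γ j ≠ 0) ∨ (γ' i ≠ 0 ∧ γ' j ≠ 0))) :
    (∀ k ∈ C, γ' k = γ k) ∨ (∀ k ∈ C, γ' k = -γ k) := by
  -- two non-zero coins for γ AND for γ'
  obtain ⟨i, hi, j, hj, hij, hγ⟩ : ∃ i ∈ C, ∃ j ∈ C, i ≠ j ∧ γ i ≠ 0 ∧ γ j ≠ 0 := by
    obtain ⟨i, hi, j, hj, hij, h | h⟩ := hsupp
    · exact ⟨i, hi, j, hj, hij, h⟩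
    · obtain ⟨i', hi', j', hj', hij', h1, h2'⟩ :=
        two_nonzero_of_two_nonzero C hC γ' γ (pairAgree_symm h2) hi hj hij h.1 h.2
      exact ⟨i', hi', j', hj', hij', h1, h2'⟩
  obtain ⟨i', hi', j', hj', hij', hγ'⟩ := two_nonzero_of_two_nonzero C hC γ γ' h2 hi hj hij hγ.1 hγ.2
  -- common zero set
  have hzero : ∀ k ∈ C, γ k = 0 ↔ γ' k = 0 := fun k hk =>
    ⟨zero_of_zero C hC γ γ' h2 h4 hi hj hij hγ.1 hγ.2 hk,
      zero_of_zero C hC γ' γ (pairAgree_symm h2) (quadAgree_symm h4) hi' hj' hij' hγ'.1 hγ'.2 hk⟩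
  -- the sign at i is the global sign
  have hγ'i : γ' i ≠ 0 := fun h => hγ.1 ((hzero i hi).2 h)
  have hsame : ∀ k ∈ C, γ k ≠ 0 → γ' k * γ k = γ' i * γ i := by
    intro k hk hγk
    by_cases hki : k = i
    · subst hki; rfl
    have hγ'k : γ' k ≠ 0 := fun h => hγk ((hzero k hk).2 h)
    exact (z3_B (γ i) (γ k) (γ' i) (γ' k) hγ.1 hγk hγ'i hγ'k (h2 i hi k hk (Ne.symm hki))).symm
  rcases z3_sign (γ i) (γ' i) hγ.1 hγ'i with hs | hs
  · left
    intro k hk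
    by_cases hγk : γ k = 0
    · rw [hγk, (hzero k hk).1 hγk]
    · have := z3_B' (γ k) (γ' k) 1 hγk (by rw [hsame k hk hγk, hs])
      rw [this, one_mul]
  · right
    intro k hk
    by_cases hγk : γ k = 0
    · rw [hγk, (hzero k hk).1 hγk, neg_zero]
    · have := z3_B' (γ k) (γ' k) (-1) hγk (by rw [hsame k hk hγk, hs])
      rw [this, neg_one_mul]

/-- **Avoidance lemma**: if no pair sum and no four-sum over distinct coins hits `a ≠ 0` then `γ` has at most one non-zero coin
on `C` (`#C ≥ 5`). -/
theorem avoid_lemma (C : Finset ι) (hC : 5 ≤ C.card) (γ : ι → ZMod 3) (a : ZMod 3) (ha : a ≠ 0)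
    (h2 : ∀ k ∈ C, ∀ l ∈ C, k ≠ l → γ k + γ l ≠ a)
    (h4 : ∀ k ∈ C, ∀ l ∈ C, ∀ m ∈ C, ∀ n ∈ C, k ≠ l → k ≠ m → k ≠ n → l ≠ m → l ≠ n → m ≠ n →
      γ k + γ l + γ m + γ n ≠ a)
    {i j : ι} (hi : i ∈ C) (hj : j ∈ C) (hij : i ≠ j) (hγi : γ i ≠ 0) : γ j = 0 := by
  by_contra hγj
  -- three further coins
  obtain ⟨m, hm, m', hm', n, hn, hmm, hmn, hm'n, hmi, hmj, hm'i, hm'j, hni, hnj⟩ := exists_three_avoiding C hC i j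
  have hnm : n ≠ m := Ne.symm hmn
  have hnm' : n ≠ m' := Ne.symm hm'n
  rcases z3_eq_or_neg (γ i) (γ j) hγi hγj with hji | hji
  · -- γ j = γ i
    have h12 := h2 i hi j hj hij
    rw [hji] at h12
    have hm0 := (z3_V1 (γ i) a (γ m) hγi ha h12 (h2 i hi m hm (Ne.symm hmi))).1
    have hav := (z3_V1 (γ i) a (γ m) hγi ha h12 (h2 i hi m hm (Ne.symm hmi))).2
    -- pair sums among m, m', n vanish
    have key : ∀ p ∈ C, ∀ q ∈ C, p ≠ q → p ≠ i → p ≠ j → q ≠ i → q ≠ j → γ p + γ q = 0 := by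
      intro p hp q hq hpq hpi hpj hqi hqj
      have hp2 := h2 p hp q hq hpq
      have hp4 := h4 i hi j hj p hp q hq hij (Ne.symm hpi) (Ne.symm hqi) (Ne.symm hpj) (Ne.symm hqj) hpq
      rw [hji, hav] at hp4
      rw [hav] at hp2
      exact z3_V2 (γ i) (γ p) (γ q) hγi hp2 hp4
    exact hm0 (zmod3_three_pairs (γ m) (γ m') (γ n) (key m hm m' hm' hmm hmi hmj hm'i hm'j)
      (key m hm n hn (Ne.symm hnm) hmi hmj hni hnj) (key m' hm' n hn (Ne.symm hnm') hm'i hm'j hni hnj))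
  · -- γ j = -γ i
    have hval : ∀ p ∈ C, p ≠ i → p ≠ j → γ p = a := by
      intro p hp hpi hpj
      have h1 := h2 i hi p hp (Ne.symm hpi)
      have h3 := h2 j hj p hp (Ne.symm hpj)
      rw [hji] at h3
      exact z3_V3 (γ i) a (γ p) hγi ha h1 h3
    have Q1 := h4 i hi m hm m' hm' n hn (Ne.symm hmi) (Ne.symm hm'i) (Ne.symm hni) hmm (Ne.symm hnm) (Ne.symm hnm')
    have Q2 := h4 j hj m hm m' hm' n hn (Ne.symm hmj) (Ne.symm hm'j) (Ne.symm hnj) hmm (Ne.symm hnm) (Ne.symm hnm')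
    rw [hval m hm hmi hmj, hval m' hm' hm'i hm'j, hval n hn hni hnj] at Q1 Q2
    rw [hji] at Q2
    exact z3_V4 (γ i) a hγi ha Q1 Q2

end AffBells26

end Summit.QuantumAdvantage.AdviceFreeQNC0
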